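import Summits.Ventures.PercRepro.SixFourPLNorm

/-!
# PercRepro — C-025 at `(6,4)`, §22.12.1 (ii): the classes of a plane-line set (p3, gen 9)

mine-2's `MINE2-RLS.md` §22.12.1 (ii): with the normalisation `D : PLData M G` (plane `P₀`, trace `ρ`, rest `L` of
rank `2`, line `ℓ = cl(L)`), every point `y ∈ ρ ∖ ℓ` determines the plane `Π_y = cl(L ∪ {y})` and its CLASS
`λ_y = Π_y ∩ ρ`:

* `Pi_mem_planes`: `Π_y` is a plane of `M` containing `L ∪ {y}`, different from `P₀` (`Pi_ne_P₀`);
* `eRk_lam_le_two`: the class has rank `≤ 2` (it lies in `Π_y ∩ P₀`, two distinct planes);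
* `Pi_eq_of_mem`: a point `z ∈ G ∖ ℓ` of `Π_y` has `Π_z = Π_y` — so two classes either coincide or meet only in
  `ℓ` (`lam_inter_subset_ellF`): the classes partition `ρ ∖ ℓ`, which is `ρ` (skew) or `ρ ∖ {z}` (meeting);
* `ellF_inter_G_subset_Pi`: `ℓ′ = ℓ ∩ G ⊆ Π_y`.
-/

namespace PercRepro.SixFour

open Finset ThmH

variable {α : Type*} [DecidableEq α] {M : Matroid α} [M.Finite] {G : Finset α}

namespace PLData

variable (D : PLData M G)

/-- `Π_y = cl(L ∪ {y})`, the plane through the rest and a point `y`. -/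
noncomputable def Pi (y : α) : Finset α := clF M (insert y D.L)

/-- `λ_y = Π_y ∩ ρ`, the class of `y`. -/
noncomputable def lam (y : α) : Finset α := D.Pi y ∩ D.ρ

variable {D}

/-- `L ∪ {y}` has rank `3` for `y ∈ G ∖ ℓ`. -/
theorem eRk_insert_L_eq_three (hs : Simple M) (hG : G ⊆ gr M) (h2 : 2 ≤ D.L.card) {y : α} (hy : y ∈ G)
    (hyℓ : y ∉ D.ellF) : M.eRk ((insert y D.L : Finset α) : Set α) = 3 := by
  have hyE : y ∈ M.E := by rw [← coe_gr]; exact_mod_cast hG hy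
  have hycl : y ∉ M.closure ((D.L : Finset α) : Set α) := by
    intro h
    apply hyℓ
    unfold ellF
    rw [mem_clF]
    exact h
  rw [Finset.coe_insert, Matroid.eRk_insert_eq_add_one ⟨hyE, hycl⟩, D.eRk_L_eq_two hs hG h2]
  rfl

/-- `Π_y` is a plane containing `L ∪ {y}`. -/
theorem Pi_mem_planes (hs : Simple M) (hG : G ⊆ gr M) (h2 : 2 ≤ D.L.card) {y : α} (hy : y ∈ G)
    (hyℓ : y ∉ D.ellF) : D.Pi y ∈ planes M ∧ insert y D.L ⊆ D.Pi y :=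
  clF_mem_planes (Finset.insert_subset (hG hy) (D.L_subset.trans hG)) (eRk_insert_L_eq_three hs hG h2 hy hyℓ)

/-- `Π_y ≠ P₀` (`L ⊆ Π_y`, `L ⊄ P₀`). -/
theorem Pi_ne_P₀ (hs : Simple M) (hG : G ⊆ gr M) (h2 : 2 ≤ D.L.card) {y : α} (hy : y ∈ G)
    (hyℓ : y ∉ D.ellF) : D.Pi y ≠ D.P₀ := by
  intro h
  obtain ⟨a, ha⟩ := Finset.card_pos.1 (by omega : 0 < D.L.card)
  have haPi : a ∈ D.Pi y := (Pi_mem_planes hs hG h2 hy hyℓ).2 (Finset.mem_insert_of_mem ha)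
  rw [h] at haPi
  unfold L at ha
  exact (Finset.mem_sdiff.1 ha).2 haPi

/-- `y ∈ λ_y`. -/
theorem mem_lam_self (hs : Simple M) (hG : G ⊆ gr M) (h2 : 2 ≤ D.L.card) {y : α} (hy : y ∈ D.ρ)
    (hyℓ : y ∉ D.ellF) : y ∈ D.lam y := by
  unfold lam
  rw [Finset.mem_inter]
  exact ⟨(Pi_mem_planes hs hG h2 (D.ρ_subset hy) hyℓ).2 (Finset.mem_insert_self _ _), hy⟩

/-- `λ_y ⊆ Π_y ∩ P₀`, hence of rank `≤ 2`. -/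
theorem eRk_lam_le_two (hs : Simple M) (hG : G ⊆ gr M) (h2 : 2 ≤ D.L.card) {y : α} (hy : y ∈ G)
    (hyℓ : y ∉ D.ellF) : M.eRk ((D.lam y : Finset α) : Set α) ≤ 2 := by
  have hsub : D.lam y ⊆ D.Pi y ∩ D.P₀ := by
    intro z hz
    unfold lam ρ at hz
    rw [Finset.mem_inter] at hz ⊢
    exact ⟨hz.1, (Finset.mem_inter.1 hz.2).1⟩
  exact (M.eRk_mono (Finset.coe_subset.2 hsub)).trans
    (eRk_inter_le_two_of_ne (Pi_mem_planes hs hG h2 hy hyℓ).1 D.plane (Pi_ne_P₀ hs hG h2 hy hyℓ))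

/-- A point `z ∈ G ∖ ℓ` of `Π_y` has `Π_z = Π_y`. -/
theorem Pi_eq_of_mem (hs : Simple M) (hG : G ⊆ gr M) (h2 : 2 ≤ D.L.card) {y z : α} (hy : y ∈ G)
    (hyℓ : y ∉ D.ellF) (hz : z ∈ G) (hzℓ : z ∉ D.ellF) (hzPi : z ∈ D.Pi y) : D.Pi z = D.Pi y := by
  have hPi := Pi_mem_planes hs hG h2 hy hyℓ
  have hsub : insert z D.L ⊆ D.Pi y :=
    Finset.insert_subset hzPi ((Finset.subset_insert y D.L).trans hPi.2)
  unfold Pi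
  apply Finset.coe_injective
  rw [coe_clF]
  exact closure_eq_of_subset_plane hPi.1 hsub (eRk_insert_L_eq_three hs hG h2 hz hzℓ)

/-- Two different classes meet only inside `ℓ`. -/
theorem lam_inter_subset_ellF (hs : Simple M) (hG : G ⊆ gr M) (h2 : 2 ≤ D.L.card) {y y' : α} (hy : y ∈ G)
    (hyℓ : y ∉ D.ellF) (hy' : y' ∈ G) (hy'ℓ : y' ∉ D.ellF) (hne : D.Pi y ≠ D.Pi y') :
    D.lam y ∩ D.lam y' ⊆ D.ellF := by
  intro z hz
  by_contra hzℓ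
  unfold lam at hz
  rw [Finset.mem_inter, Finset.mem_inter, Finset.mem_inter] at hz
  have hzG : z ∈ G := D.ρ_subset hz.1.2
  apply hne
  rw [← Pi_eq_of_mem hs hG h2 hy hyℓ hzG hzℓ hz.1.1, ← Pi_eq_of_mem hs hG h2 hy' hy'ℓ hzG hzℓ hz.2.1]

/-- `ℓ ⊆ Π_y`. -/
theorem ellF_subset_Pi (y : α) : D.ellF ⊆ D.Pi y := by
  unfold ellF Pi
  rw [← Finset.coe_subset, coe_clF, coe_clF]
  exact M.closure_subset_closure (Finset.coe_subset.2 (Finset.subset_insert y D.L))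

/-- A point of `G` outside `ℓ` lies in `ρ`. -/
theorem mem_ρ_of_notMem_ellF (hs : Simple M) (hG : G ⊆ gr M) (h2 : 2 ≤ D.L.card) {y : α} (hy : y ∈ G)
    (hyℓ : y ∉ D.ellF) : y ∈ D.ρ := by
  unfold ρ
  rw [Finset.mem_inter]
  refine ⟨?_, hy⟩
  by_contra hyP
  exact hyℓ (D.L_subset_ellF hs hG h2 (Finset.mem_sdiff.2 ⟨hy, hyP⟩))

/-- The meeting point: in the meeting case `ℓ ∩ ρ = {z}` and `z ∈ λ_y` for every class. -/
theorem mem_lam_of_mem_ellF {y z : α} (hz : z ∈ D.ellF) (hzρ : z ∈ D.ρ) : z ∈ D.lam y := by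
  unfold lam
  rw [Finset.mem_inter]
  exact ⟨ellF_subset_Pi y hz, hzρ⟩

/-- The trace of `Π_y` on `G` is `λ_y ∪ (ℓ ∩ G)`: every point of `Π_y ∩ G` is in `ρ` (hence in `λ_y`) or in
`L ⊆ ℓ`. -/
theorem Pi_inter_eq (hs : Simple M) (hG : G ⊆ gr M) (h2 : 2 ≤ D.L.card) (y : α) :
    D.Pi y ∩ G = D.lam y ∪ (D.ellF ∩ G) := by
  ext z
  unfold lam ρ
  rw [Finset.mem_inter, Finset.mem_union, Finset.mem_inter, Finset.mem_inter, Finset.mem_inter]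
  constructor
  · rintro ⟨hzPi, hzG⟩
    by_cases hzP : z ∈ D.P₀
    · exact Or.inl ⟨hzPi, hzP, hzG⟩
    · exact Or.inr ⟨D.L_subset_ellF hs hG h2 (Finset.mem_sdiff.2 ⟨hzG, hzP⟩), hzG⟩
  · rintro (⟨hzPi, -, hzG⟩ | ⟨hzℓ, hzG⟩)
    · exact ⟨hzPi, hzG⟩
    · exact ⟨ellF_subset_Pi y hzℓ, hzG⟩

end PLData

end PercRepro.SixFour
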